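import Summits.AtomisticToContinuum.HydrodynamicLimit.Theses.BoxDissipativeWeakStrong
import Summits.AtomisticToContinuum.HydrodynamicLimit.Theorems.BoxDissipativeWeakStrongDefs
import Summits.AtomisticToContinuum.HydrodynamicLimit.Theorems.BoxDissipativeWeakStrongLocalGibbsFineScalePos

/-!
# Crux `EntropyAdmissibility` (stmt-AtomisticToContinuum-9903), line `registered` — stub `stub_initialEntropyLLN_of_modulus`

S0b of the lead's skeleton: the INITIAL part of the clamp-renormalised entropy balance converges
in `L¹(P_N)` to its deterministic value on the Euler data, `E_{P_N} |B_N − B| → 0`, GIVEN the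
uniform modulus of continuity of the clamped cut entropy `G(r, m, e) = Z_{a,b}(s_cut(r, θ̂))`
near compact sets of physical band states (stub S0a, the hypothesis `Sig.stub_entropyModulus`).

Proof. `η_c := η₀` of `HsEosLowDensity` (`f_ex` agrees on `[0, η₀)` with a function analytic on
`(-η₀, η₀)`, so it is continuous there); `σ₀ := min σ₀^{LGFS} (1/2)`. From `τ ∈ [0, T)`, `0 < T`,
so the time-`0` slices `ρ₀, u₀, θ₀, φ₀` are continuous, `ρ₀, θ₀ > 0`, and
`K = range (x ↦ (ρ₀, ρ₀ u₀, E(ρ₀, u₀, θ₀))(x))` is a compact set of band states (`θ̂ = θ₀` on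
consistent states, `BDWS.boxTemp_consState`). With `M = |a| ∨ |b|`, `R = sup ρ₀`, `B = sup |φ₀|`
and the `δ` of S0a at accuracy `ε`: `|ρ̂ G(q̂) φ₀ − ρ₀ G(p) φ₀| ≤ B R ε + B (M + 2MR/δ) dev`
pointwise, `dev = |ρ̂ − ρ₀| + ‖m̂ − ρ₀u₀‖ + |Ê − E₀| ≥ dist q̂ p` (if `dist < δ` the modulus gives
`ε`, else `|G q̂ − G p| ≤ 2M ≤ (2M/δ) dev`). The box fields are measurable and integrable in `x`
(finite sums of box indicators), the clamped entropy is measurable in `x` (`f_ex` is continuous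
on `[0, η₀) ∋ min(ρ̂σ³, η₁)` as `ρ̂ ≥ 0`), so `|∫ f − ∫ g| ≤ ∫ |f − g|`, and
`E_P ofReal (∫ dev dx) → 0` is the landed `LGFS.localGibbsFineScale_of_pos` verbatim
(`BDWS.boxDensity … 0 z x` unfolds to its `Dn N 0 z x`); conclude with `ε → 0`. References:
Březina–Feireisl, J. Math. Soc. Japan 70 (2018), Def. 2.9, §3.2; Spohn (1991), Part I Ch. 3.
-/
noncomputable section

open MeasureTheory Filter Set
open scoped ENNReal Topology

namespace Summit.AtomisticToContinuum.HydrodynamicLimit.Theorems.EABirthS0b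

open Literature.MathematicalPhysics.KineticTheory
open Literature.Analysis.FluidPDE.CompressibleEuler (clamp abs_clamp_le continuous_clamp)
open Summit.AtomisticToContinuum.HydrodynamicLimit.Theses
open Summit.AtomisticToContinuum.HydrodynamicLimit.Theorems.BDWS

/-! ## Elementary real estimates -/

/-- From a modulus of continuity at scale `δ` to a linear bound: if `|G| ≤ M` at `p` and `q` and
`dist q p < δ → |G q - G p| < ε`, then `|G q - G p| ≤ ε + (2M/δ) D` for every `D ≥ dist q p`. -/
theorem abs_sub_le_of_modulus {X : Type*} [PseudoMetricSpace X] {G : X → ℝ} {M ε δ D : ℝ}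
    {p q : X} (hMq : |G q| ≤ M) (hMp : |G p| ≤ M) (hδ : 0 < δ) (hε : 0 ≤ ε)
    (hmod : dist q p < δ → |G q - G p| < ε) (hD : dist q p ≤ D) :
    |G q - G p| ≤ ε + 2 * M / δ * D := by
  have hM : 0 ≤ M := (abs_nonneg _).trans hMq
  have hD0 : 0 ≤ D := dist_nonneg.trans hD
  by_cases h : dist q p < δ
  · have h2 : 0 ≤ 2 * M / δ * D := by positivity
    linarith [(hmod h).le]
  · have h2 : |G q - G p| ≤ 2 * M := (abs_sub _ _).trans (by linarith)
    have h3 : 2 * M ≤ 2 * M / δ * D := by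
      rw [div_mul_eq_mul_div, le_div_iff₀ hδ]
      exact mul_le_mul_of_nonneg_left ((not_lt.1 h).trans hD) (by linarith)
    linarith

/-- The algebra of the pointwise estimate: `|r G φ − r₀ G₀ φ| ≤ B R ε + B (M + K R) D` from
`|G| ≤ M`, `|G − G₀| ≤ ε + K D`, `|r − r₀| ≤ D`, `|r₀| ≤ R`, `|φ| ≤ B`. -/
theorem abs_mul_mul_sub_le {r r₀ G G₀ p M R B ε K D : ℝ} (hM : |G| ≤ M)
    (hGG : |G - G₀| ≤ ε + K * D) (hr : |r - r₀| ≤ D) (hR : |r₀| ≤ R) (hB : |p| ≤ B)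
    (hε : 0 ≤ ε) (hK : 0 ≤ K) :
    |r * G * p - r₀ * G₀ * p| ≤ B * R * ε + B * (M + K * R) * D := by
  have hM0 : 0 ≤ M := (abs_nonneg _).trans hM
  have hR0 : 0 ≤ R := (abs_nonneg _).trans hR
  have hD0 : 0 ≤ D := (abs_nonneg _).trans hr
  have h1 : r * G * p - r₀ * G₀ * p = ((r - r₀) * G + r₀ * (G - G₀)) * p := by ring
  have h2 : |(r - r₀) * G + r₀ * (G - G₀)| ≤ D * M + R * (ε + K * D) :=
    calc |(r - r₀) * G + r₀ * (G - G₀)| ≤ |(r - r₀) * G| + |r₀ * (G - G₀)| := abs_add_le _ _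
      _ = |r - r₀| * |G| + |r₀| * |G - G₀| := by rw [abs_mul, abs_mul]
      _ ≤ D * M + R * (ε + K * D) := add_le_add (mul_le_mul hr hM (abs_nonneg _) hD0)
          (mul_le_mul hR hGG (abs_nonneg _) hR0)
  rw [h1, abs_mul]
  calc |(r - r₀) * G + r₀ * (G - G₀)| * |p| ≤ (D * M + R * (ε + K * D)) * B :=
        mul_le_mul h2 hB (abs_nonneg _) (by positivity)
    _ = B * R * ε + B * (M + K * R) * D := by ring

/-- The sup distance on `ℝ × V3 × ℝ` is dominated by the sum of the coordinate distances. -/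
theorem dist_le_sum3 (q p : ℝ × V3 × ℝ) :
    dist q p ≤ |q.1 - p.1| + ‖q.2.1 - p.2.1‖ + |q.2.2 - p.2.2| := by
  rw [Prod.dist_eq, Prod.dist_eq, Real.dist_eq, dist_eq_norm, Real.dist_eq]
  have h := abs_nonneg (q.1 - p.1); have h' := norm_nonneg (q.2.1 - p.2.1)
  exact max_le (by linarith [abs_nonneg (q.2.2 - p.2.2)])
    (max_le (by linarith [abs_nonneg (q.2.2 - p.2.2)]) (by linarith))

/-! ## Measurability of the clamped cut entropy -/

/-- The box temperature of measurable fields is measurable (junk `x / 0 = 0` included). -/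
theorem measurable_boxTemp {α : Type*} [MeasurableSpace α] {r E : α → ℝ} {m : α → V3}
    (hr : Measurable r) (hm : Measurable m) (hE : Measurable E) :
    Measurable fun x => boxTemp (r x) (m x) (E x) := by
  unfold boxTemp
  exact measurable_const.mul ((hE.div hr).sub
    ((hm.norm.pow_const 2).div (measurable_const.mul (hr.pow_const 2))))

/-- **Measurability of the clamped cut entropy** `x ↦ Z_{a,b}(s_cut(r x, ϑ x))` for measurable
`r ≥ 0` and `ϑ`, when `f_ex` is continuous on `[0, η₀) ⊇ [0, η₁]`: the argument
`min (r σ³) η₁` of `f_ex` stays in `[0, η₁]` (the only non-elementary ingredient; `log`, `clamp`,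
`min`, `max`, `/` are measurable with their junk values). -/
theorem measurable_clamp_cutEntropy {α : Type*} [MeasurableSpace α] {r ϑ : α → ℝ}
    (hr : Measurable r) (hϑ : Measurable ϑ) (hr0 : ∀ x, 0 ≤ r x) {η₀ σ η₁ : ℝ}
    (hcont : ContinuousOn hsExcessFreeEnergy (Ico 0 η₀)) (hσ : 0 ≤ σ) (hη₁ : 0 ≤ η₁)
    (hη₁c : η₁ < η₀) (a b : ℝ) :
    Measurable fun x => clamp a b (cutEntropy σ η₁ (r x) (ϑ x)) := by
  have hmin : ∀ x, min (r x * σ ^ 3) η₁ ∈ Ico 0 η₀ := fun x =>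
    ⟨le_min (mul_nonneg (hr0 x) (pow_nonneg hσ 3)) hη₁, (min_le_right _ _).trans_lt hη₁c⟩
  -- `f_ex (min (r σ³) η₁)` factors through the restriction of `f_ex` to `[0, η₀)`
  have h1 : Measurable fun x => hsExcessFreeEnergy (min (r x * σ ^ 3) η₁) :=
    (continuousOn_iff_continuous_restrict.1 hcont).measurable.comp
      (f := fun x => (⟨min (r x * σ ^ 3) η₁, hmin x⟩ : Ico (0 : ℝ) η₀))
      ((hr.mul_const _).min measurable_const).subtype_mk
  have h2 : Measurable fun x => cutExcessFreeEnergy η₁ (r x * σ ^ 3) := by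
    unfold cutExcessFreeEnergy
    exact h1.add (measurable_const.mul (Real.measurable_log.comp
      (((hr.mul_const _).max measurable_const).div_const _)))
  unfold cutEntropy
  exact (continuous_clamp a b).measurable.comp (((measurable_const.mul
    (Real.measurable_log.comp hϑ)).sub (Real.measurable_log.comp hr)).sub h2)

/-! ## The box fields in the centre variable `x` -/

/-- The box kernel, as a function of its centre `x` for a fixed point `y`, is integrable
(`LGFS.measurable_boxK_uncurry`, `LGFS.integrable_kernel` in the `BDWS` vocabulary). -/
theorem integrable_boxKernel_left {l : ℝ} (hl : 0 ≤ l) (y : T3) :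
    Integrable fun x : T3 => boxKernel l x y := by
  have hk : Measurable fun p : T3 × T3 => boxKernel l p.1 p.2 := LGFS.measurable_boxK_uncurry l
  refine LGFS.integrable_kernel ?_ (fun x => LGFS.boxK_nonneg hl x y) (fun x => LGFS.boxK_le hl x y)
  exact hk.comp (f := fun x : T3 => (x, y)) (measurable_id.prodMk measurable_const)

/-- **The box fields are measurable in the centre** `x` (fixed `N`, `t`, `z`). -/
theorem measurable_boxFields (σ : ℝ) (ℓ : ℕ → ℝ) (Φ : FlowFamily σ) (N : ℕ) (t : ℝ)
    (z : Literature.Analysis.FluidPDE.Config (N + 1) (Fin 3) T3) :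
    Measurable (fun x => boxDensity σ ℓ Φ N t z x) ∧
      Measurable (fun x => boxMomentum σ ℓ Φ N t z x) ∧
        Measurable (fun x => boxEnergy σ ℓ Φ N t z x) := by
  have hk : Measurable fun p : T3 × T3 => boxKernel (ℓ N) p.1 p.2 :=
    LGFS.measurable_boxK_uncurry (ℓ N)
  have hι : Measurable fun x : T3 => ((Φ N).flow t z, x) := measurable_const.prodMk measurable_id
  refine ⟨?_, ?_, ?_⟩
  · have h : (fun x => boxDensity σ ℓ Φ N t z x) =
        (fun p : Literature.Analysis.FluidPDE.Config (N + 1) (Fin 3) T3 × T3 =>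
          empiricalDensityField p.1 (boxKernel (ℓ N) p.2)) ∘ fun x => ((Φ N).flow t z, x) := rfl
    rw [h]; exact (LGFS.measurable_empiricalDensityField_param hk).comp hι
  · have h : (fun x => boxMomentum σ ℓ Φ N t z x) =
        (fun p : Literature.Analysis.FluidPDE.Config (N + 1) (Fin 3) T3 × T3 =>
          empiricalMomentumField p.1 (boxKernel (ℓ N) p.2)) ∘ fun x => ((Φ N).flow t z, x) := rfl
    rw [h]; exact (LGFS.measurable_empiricalMomentumField_param hk).comp hι
  · have h : (fun x => boxEnergy σ ℓ Φ N t z x) =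
        (fun p : Literature.Analysis.FluidPDE.Config (N + 1) (Fin 3) T3 × T3 =>
          empiricalEnergyField p.1 (boxKernel (ℓ N) p.2)) ∘ fun x => ((Φ N).flow t z, x) := rfl
    rw [h]; exact (LGFS.measurable_empiricalEnergyField_param hk).comp hι

/-- **The box fields are integrable in the centre** `x` (finite sums of box indicators). -/
theorem integrable_boxFields (σ : ℝ) {ℓ : ℕ → ℝ} (Φ : FlowFamily σ) (N : ℕ) (hl : 0 ≤ ℓ N)
    (t : ℝ) (z : Literature.Analysis.FluidPDE.Config (N + 1) (Fin 3) T3) :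
    Integrable (fun x => boxDensity σ ℓ Φ N t z x) ∧
      Integrable (fun x => boxMomentum σ ℓ Φ N t z x) ∧
        Integrable (fun x => boxEnergy σ ℓ Φ N t z x) := by
  have hK : ∀ y : T3, Integrable fun x : T3 => boxKernel (ℓ N) x y := fun y =>
    integrable_boxKernel_left hl y
  simp only [boxDensity, boxMomentum, boxEnergy, empiricalDensityField_eq_sum,
    empiricalMomentumField_eq_sum, empiricalEnergyField_eq_sum]
  exact ⟨(integrable_finsetSum _ fun i _ => hK _).const_mul _,
    (integrable_finsetSum _ fun i _ => (hK _).smul_const _).fun_smul _,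
    (integrable_finsetSum _ fun i _ => (hK _).mul_const _).const_mul _⟩

/-- The box density is nonnegative. -/
theorem boxDensity_nonneg (σ : ℝ) {ℓ : ℕ → ℝ} (Φ : FlowFamily σ) (N : ℕ) (hl : 0 ≤ ℓ N) (t : ℝ)
    (z : Literature.Analysis.FluidPDE.Config (N + 1) (Fin 3) T3) (x : T3) :
    0 ≤ boxDensity σ ℓ Φ N t z x := by
  unfold boxDensity
  rw [empiricalDensityField_eq_sum]
  exact mul_nonneg (inv_nonneg.2 (Nat.cast_nonneg _))
    (Finset.sum_nonneg fun i _ => LGFS.boxK_nonneg hl x _)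

/-! ## The abstract `L¹` squeeze -/

/-- **Abstract assembly.** On probability spaces `(Ω_N, P_N)` and a probability space `(α, μ)`:
if `E_{P_N} ofReal (∫ dev_N dμ) → 0`, the integrands `f_N(z, ·)`, `g`, `dev_N(z, ·) ≥ 0` are
`μ`-integrable, and for every `ε > 0` there is `C ≥ 0` with `|f_N(z, x) − g(x)| ≤ ε + C dev_N(z, x)`
pointwise, then `E_{P_N} |∫ f_N(z, ·) dμ − ∫ g dμ| → 0`. -/
theorem tendsto_lintegral_abs_integral_sub {Ω : ℕ → Type*} [∀ N, MeasurableSpace (Ω N)]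
    (P : ∀ N, Measure (Ω N)) (hP : ∀ N, IsProbabilityMeasure (P N))
    {α : Type*} [MeasurableSpace α] (μ : Measure α) [IsProbabilityMeasure μ]
    (f : ∀ N, Ω N → α → ℝ) (g : α → ℝ) (dev : ∀ N, Ω N → α → ℝ)
    (hconv : Tendsto (fun N => ∫⁻ z, ENNReal.ofReal (∫ x, dev N z x ∂μ) ∂P N) atTop (𝓝 0))
    (hf : ∀ N z, Integrable (f N z) μ) (hg : Integrable g μ)
    (hdev : ∀ N z, Integrable (dev N z) μ) (hdev0 : ∀ N z x, 0 ≤ dev N z x)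
    (hpt : ∀ ε : ℝ, 0 < ε → ∃ C : ℝ, 0 ≤ C ∧ ∀ N z x, |f N z x - g x| ≤ ε + C * dev N z x) :
    Tendsto (fun N => ∫⁻ z, ENNReal.ofReal |(∫ x, f N z x ∂μ) - ∫ x, g x ∂μ| ∂P N)
      atTop (𝓝 0) := by
  rw [ENNReal.tendsto_nhds_zero]
  intro ε' hε'
  rcases eq_or_ne ε' ⊤ with hε't | hε't
  · exact Eventually.of_forall fun N => hε't ▸ le_top
  have he : 0 < ε'.toReal := ENNReal.toReal_pos hε'.ne' hε't
  set e := ε'.toReal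
  obtain ⟨C, hC0, hC⟩ := hpt (e / 2) (half_pos he)
  have hev : ∀ᶠ N in atTop, ENNReal.ofReal C * ∫⁻ z, ENNReal.ofReal (∫ x, dev N z x ∂μ) ∂P N ≤
      ENNReal.ofReal (e / 2) := by
    have h1 := ENNReal.Tendsto.const_mul hconv (Or.inr ENNReal.ofReal_ne_top)
      (a := ENNReal.ofReal C)
    rw [mul_zero] at h1
    exact ENNReal.tendsto_nhds_zero.1 h1 _ (ENNReal.ofReal_pos.2 (half_pos he))
  filter_upwards [hev] with N hN
  haveI := hP N
  rw [← ENNReal.ofReal_toReal hε't]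
  have hpoint : ∀ z x, ENNReal.ofReal |f N z x - g x| ≤
      ENNReal.ofReal (e / 2) + ENNReal.ofReal C * ENNReal.ofReal (dev N z x) := fun z x => by
    rw [← ENNReal.ofReal_mul hC0, ← ENNReal.ofReal_add (half_pos he).le (mul_nonneg hC0 (hdev0 N z x))]
    exact ENNReal.ofReal_le_ofReal (hC N z x)
  have hinner : ∀ z,
      ∫⁻ x, (ENNReal.ofReal (e / 2) + ENNReal.ofReal C * ENNReal.ofReal (dev N z x)) ∂μ =
        ENNReal.ofReal (e / 2) + ENNReal.ofReal C * ENNReal.ofReal (∫ x, dev N z x ∂μ) := fun z => by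
    rw [lintegral_add_left measurable_const, lintegral_const, measure_univ, mul_one,
      lintegral_const_mul' _ _ ENNReal.ofReal_ne_top,
      ← ofReal_integral_eq_lintegral_ofReal (hdev N z) (ae_of_all _ (hdev0 N z))]
  have habs : ∀ z, ENNReal.ofReal |(∫ x, f N z x ∂μ) - ∫ x, g x ∂μ| ≤
      ∫⁻ x, ENNReal.ofReal |f N z x - g x| ∂μ := fun z => by
    rw [← integral_sub (hf N z) hg]
    have h := enorm_integral_le_lintegral_enorm (μ := μ) (fun x => f N z x - g x)
    simpa only [Real.enorm_eq_ofReal_abs] using h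
  calc ∫⁻ z, ENNReal.ofReal |(∫ x, f N z x ∂μ) - ∫ x, g x ∂μ| ∂P N
      ≤ ∫⁻ z, ∫⁻ x, ENNReal.ofReal |f N z x - g x| ∂μ ∂P N := lintegral_mono fun z => habs z
    _ ≤ ∫⁻ z, ∫⁻ x, (ENNReal.ofReal (e / 2) + ENNReal.ofReal C * ENNReal.ofReal (dev N z x)) ∂μ ∂P N :=
        lintegral_mono fun z => lintegral_mono fun x => hpoint z x
    _ = ∫⁻ z, (ENNReal.ofReal (e / 2) + ENNReal.ofReal C * ENNReal.ofReal (∫ x, dev N z x ∂μ)) ∂P N :=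
        lintegral_congr fun z => hinner z
    _ = ENNReal.ofReal (e / 2) + ENNReal.ofReal C * ∫⁻ z, ENNReal.ofReal (∫ x, dev N z x ∂μ) ∂P N := by
        rw [lintegral_add_left measurable_const, lintegral_const, measure_univ, mul_one,
          lintegral_const_mul' _ _ ENNReal.ofReal_ne_top]
    _ ≤ ENNReal.ofReal (e / 2) + ENNReal.ofReal (e / 2) := add_le_add le_rfl hN
    _ = ENNReal.ofReal e := by
        rw [← ENNReal.ofReal_add (half_pos he).le (half_pos he).le, add_halves]

/-! ## The stub -/

/-- Signature of the stub S0b: `Sig.stub_entropyModulus → Sig.stub_initialEntropyLLN` of the lead's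
skeleton, with both bodies inlined (definitionally the skeleton's statement). -/
def Sig.stub_initialEntropyLLN_of_modulus : Prop :=
  (∀ η₀ : ℝ, 0 < η₀ → ContinuousOn hsExcessFreeEnergy (Ico 0 η₀) →
    ∀ (σ η₁ a b : ℝ), 0 < σ → 0 < η₁ → η₁ < η₀ →
      ∀ K : Set (ℝ × V3 × ℝ), IsCompact K →
        (∀ p ∈ K, 0 < p.1 ∧ p.1 * σ ^ 3 < η₁ ∧ 0 < boxTemp p.1 p.2.1 p.2.2) →
        ∀ ε : ℝ, 0 < ε → ∃ δ : ℝ, 0 < δ ∧ ∀ p ∈ K, ∀ q : ℝ × V3 × ℝ, dist q p < δ →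
          |clamp a b (cutEntropy σ η₁ q.1 (boxTemp q.1 q.2.1 q.2.2)) -
              clamp a b (cutEntropy σ η₁ p.1 (boxTemp p.1 p.2.1 p.2.2))| < ε) →
      (BoxDissipativeWeakStrong.HsEosLowDensity →
    ∃ ηc : ℝ, 0 < ηc ∧ ∀ η₁ : ℝ, 0 < η₁ → η₁ < ηc →
      ∀ (a₀ θ₀ : T3 → ℝ) (u₀ : T3 → V3), Continuous a₀ → Continuous θ₀ → Continuous u₀ →
        (∀ x, 0 < a₀ x) → (∀ x, 0 < θ₀ x) →
        ∃ σ₀ : ℝ, 0 < σ₀ ∧ ∀ σ : ℝ, 0 < σ → σ < σ₀ →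
          ∀ (T : ℝ) (ρ θ : ℝ → T3 → ℝ) (u : ℝ → T3 → V3), IsHardSphereEulerSolution σ T ρ u θ →
            (∀ t ∈ Ico 0 T, ∀ x, ρ t x * σ ^ 3 ≤ η₁ / 2) →
            ∀ Φ : FlowFamily σ,
              TendstoHydroFieldsAt (fun N => localGibbsLaw σ a₀ u₀ θ₀ N (Φ N)) Φ ρ u θ 0 →
              ∀ ℓ : ℕ → ℝ, (∀ N, 0 < ℓ N ∧ ℓ N ≤ 1) → Tendsto ℓ atTop (𝓝 0) →
                Tendsto (fun N : ℕ => ℓ N ^ 3 * ((N : ℝ) + 1)) atTop atTop →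
                ∀ τ ∈ Ico 0 T, ∀ a b : ℝ, a < b → ∀ φ : ℝ → T3 → ℝ,
                  Literature.Analysis.FunctionSpaces.Torus.IsSmoothSpaceTimeOn (Ico 0 T) φ →
                  (∀ t ∈ Icc 0 τ, ∀ x, 0 ≤ φ t x) →
                  Tendsto (fun N : ℕ => ∫⁻ z, ENNReal.ofReal
                      |initPart σ η₁ ℓ Φ a b φ N z - initLimit σ η₁ ρ θ a b φ|
                    ∂(localGibbsLaw σ a₀ u₀ θ₀ N (Φ N))) atTop (𝓝 0))

/-- **Stub S0b** (crux stmt-AtomisticToContinuum-9903, line `registered`): the initial entropy LLN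
`E_{P_N} |B_N − B| → 0` from the modulus of continuity of the clamped cut entropy (S0a) and the
landed fine-scale LLN `LGFS.localGibbsFineScale_of_pos`. -/
theorem stub_initialEntropyLLN_of_modulus : Sig.stub_initialEntropyLLN_of_modulus := by
  intro hmod hEos
  obtain ⟨η₀, hη₀, F, hFan, hFeq, -⟩ := hEos
  have hcont : ContinuousOn hsExcessFreeEnergy (Ico 0 η₀) :=
    (hFan.continuousOn.mono fun x hx => ⟨by linarith [hx.1], hx.2⟩).congr hFeq
  refine ⟨η₀, hη₀, ?_⟩
  intro η₁ hη₁ hη₁c a₀ θ₀ u₀ ha hθ hu ha0 hθ0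
  obtain ⟨σ₁, hσ₁, G1⟩ := LGFS.localGibbsFineScale_of_pos a₀ θ₀ u₀ ha hθ hu ha0 hθ0
  refine ⟨min σ₁ (1 / 2), lt_min hσ₁ one_half_pos, ?_⟩
  intro σ hσ hσlt T ρ θ u hsol hguard Φ hLLN ℓ hℓ hℓ0 hℓ3 τ hτ a b hab φ hφ _hφ0
  have h0T : (0 : ℝ) ∈ Ico 0 T := ⟨le_rfl, hτ.1.trans_lt hτ.2⟩
  have hσ2 : σ ≤ 1 / 2 := (hσlt.trans_le (min_le_right _ _)).le
  have hP : ∀ N, IsProbabilityMeasure (localGibbsLaw σ a₀ u₀ θ₀ N (Φ N)) := fun N =>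
    isProbabilityMeasure_localGibbsLaw ha hθ hu ha0 hθ0 hσ2 N (Φ N)
  -- the landed fine-scale LLN, in the `BDWS` vocabulary
  have hconv : Tendsto (fun N : ℕ => ∫⁻ z, ENNReal.ofReal (∫ x,
      (|boxDensity σ ℓ Φ N 0 z x - ρ 0 x| + ‖boxMomentum σ ℓ Φ N 0 z x - ρ 0 x • u 0 x‖ +
        |boxEnergy σ ℓ Φ N 0 z x - totalEnergyDensity (ρ 0 x) (u 0 x) (θ 0 x)|))
      ∂(localGibbsLaw σ a₀ u₀ θ₀ N (Φ N))) atTop (𝓝 0) :=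
    G1 σ hσ (hσlt.trans_le (min_le_left _ _)) T ρ θ u hsol h0T.2 Φ hLLN ℓ hℓ hℓ0 hℓ3
  -- the time-`0` slices
  have hρc : Continuous (ρ 0) := (hsol.smooth_density.isSmooth_slice h0T).continuous
  have huc : Continuous (u 0) := (hsol.smooth_velocity.isSmooth_slice h0T).continuous
  have hθc : Continuous (θ 0) := (hsol.smooth_temperature.isSmooth_slice h0T).continuous
  have hφc : Continuous (φ 0) := (hφ.isSmooth_slice h0T).continuous
  have hEc : Continuous fun x => totalEnergyDensity (ρ 0 x) (u 0 x) (θ 0 x) := by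
    unfold totalEnergyDensity; fun_prop
  have hρpos : ∀ x, 0 < ρ 0 x := hsol.density_pos 0 h0T
  have hθpos : ∀ x, 0 < θ 0 x := hsol.temperature_pos 0 h0T
  obtain ⟨R, hR0, hR⟩ := exists_forall_abs_le_of_continuous hρc
  obtain ⟨B, hB0, hB⟩ := exists_forall_abs_le_of_continuous hφc
  -- the compact set of base states and the band condition
  set pmap : T3 → ℝ × V3 × ℝ := fun x =>
    (ρ 0 x, ρ 0 x • u 0 x, totalEnergyDensity (ρ 0 x) (u 0 x) (θ 0 x)) with hpmap
  have hK : IsCompact (range pmap) := isCompact_range (hρc.prodMk ((hρc.smul huc).prodMk hEc))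
  have hband : ∀ p ∈ range pmap, 0 < p.1 ∧ p.1 * σ ^ 3 < η₁ ∧ 0 < boxTemp p.1 p.2.1 p.2.2 := by
    rintro p ⟨x, rfl⟩
    refine ⟨hρpos x, (hguard 0 h0T x).trans_lt (by linarith), ?_⟩
    show 0 < boxTemp (ρ 0 x) (ρ 0 x • u 0 x) (totalEnergyDensity (ρ 0 x) (u 0 x) (θ 0 x))
    rw [boxTemp_consState (hρpos x).ne']; exact hθpos x
  -- the clamped cut entropy as a function of the state
  set G : ℝ × V3 × ℝ → ℝ := fun q =>
    clamp a b (cutEntropy σ η₁ q.1 (boxTemp q.1 q.2.1 q.2.2)) with hG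
  have hGM : ∀ q, |G q| ≤ max |a| |b| := fun q => abs_clamp_le hab.le _
  have hGp : ∀ x, G (pmap x) = clamp a b (cutEntropy σ η₁ (ρ 0 x) (θ 0 x)) := fun x => by
    simp only [hG, hpmap, boxTemp_consState (hρpos x).ne']
  -- measurability and integrability in the centre variable
  have hmeas := fun N z => measurable_boxFields σ ℓ Φ N 0 z
  have hint := fun N z => integrable_boxFields σ Φ N (hℓ N).1.le 0 z
  have hDn0 := fun N z x => boxDensity_nonneg σ Φ N (hℓ N).1.le 0 z x
  have hGm : ∀ N z, Measurable fun x => boxClampedEntropy σ η₁ ℓ Φ a b N 0 z x := fun N z =>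
    measurable_clamp_cutEntropy (hmeas N z).1
      (measurable_boxTemp (hmeas N z).1 (hmeas N z).2.1 (hmeas N z).2.2) (hDn0 N z)
      hcont hσ.le hη₁.le hη₁c a b
  have hbd : ∀ᵐ x : T3, ‖φ 0 x‖ ≤ B := ae_of_all _ fun x => (Real.norm_eq_abs _).trans_le (hB x)
  have hfi : ∀ N z, Integrable fun x =>
      boxDensity σ ℓ Φ N 0 z x * boxClampedEntropy σ η₁ ℓ Φ a b N 0 z x * φ 0 x := fun N z =>
    ((hint N z).1.mul_bdd (hGm N z).aestronglyMeasurable (ae_of_all _ fun x =>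
      (Real.norm_eq_abs _).trans_le (hGM (boxDensity σ ℓ Φ N 0 z x, boxMomentum σ ℓ Φ N 0 z x,
        boxEnergy σ ℓ Φ N 0 z x)))).mul_bdd hφc.aestronglyMeasurable hbd
  have hgi : Integrable fun x => ρ 0 x * clamp a b (cutEntropy σ η₁ (ρ 0 x) (θ 0 x)) * φ 0 x :=
    ((integrable_of_continuous_T3 hρc).mul_bdd
      (measurable_clamp_cutEntropy hρc.measurable hθc.measurable (fun x => (hρpos x).le) hcont
        hσ.le hη₁.le hη₁c a b).aestronglyMeasurable
      (ae_of_all _ fun x => (Real.norm_eq_abs _).trans_le (abs_clamp_le hab.le _))).mul_bdd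
      hφc.aestronglyMeasurable hbd
  have hdevi : ∀ N z, Integrable fun x =>
      |boxDensity σ ℓ Φ N 0 z x - ρ 0 x| + ‖boxMomentum σ ℓ Φ N 0 z x - ρ 0 x • u 0 x‖ +
        |boxEnergy σ ℓ Φ N 0 z x - totalEnergyDensity (ρ 0 x) (u 0 x) (θ 0 x)| := fun N z =>
    (((hint N z).1.sub' (integrable_of_continuous_T3 hρc)).abs.fun_add
      ((hint N z).2.1.sub' (integrable_of_continuous_T3 (hρc.smul huc))).norm).fun_add
      ((hint N z).2.2.sub' (integrable_of_continuous_T3 hEc)).abs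
  -- the pointwise estimate
  have hpt : ∀ ε : ℝ, 0 < ε → ∃ C : ℝ, 0 ≤ C ∧ ∀ (N : ℕ)
      (z : Literature.Analysis.FluidPDE.Config (N + 1) (Fin 3) T3) (x : T3),
      |boxDensity σ ℓ Φ N 0 z x * boxClampedEntropy σ η₁ ℓ Φ a b N 0 z x * φ 0 x -
          ρ 0 x * clamp a b (cutEntropy σ η₁ (ρ 0 x) (θ 0 x)) * φ 0 x| ≤
        ε + C * (|boxDensity σ ℓ Φ N 0 z x - ρ 0 x| + ‖boxMomentum σ ℓ Φ N 0 z x - ρ 0 x • u 0 x‖ +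
          |boxEnergy σ ℓ Φ N 0 z x - totalEnergyDensity (ρ 0 x) (u 0 x) (θ 0 x)|) := by
    intro ε hε
    have hε₁ : 0 < ε / (B * R + 1) := div_pos hε (by positivity)
    obtain ⟨δ, hδ, hmodK⟩ :=
      hmod η₀ hη₀ hcont σ η₁ a b hσ hη₁ hη₁c (range pmap) hK hband (ε / (B * R + 1)) hε₁
    have hM0 : 0 ≤ max |a| |b| := (abs_nonneg _).trans (le_max_left _ _)
    refine ⟨B * (max |a| |b| + 2 * max |a| |b| / δ * R), by positivity, fun N z x => ?_⟩
    set q : ℝ × V3 × ℝ := (boxDensity σ ℓ Φ N 0 z x, boxMomentum σ ℓ Φ N 0 z x,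
      boxEnergy σ ℓ Φ N 0 z x) with hq
    set D : ℝ := |boxDensity σ ℓ Φ N 0 z x - ρ 0 x| + ‖boxMomentum σ ℓ Φ N 0 z x - ρ 0 x • u 0 x‖ +
      |boxEnergy σ ℓ Φ N 0 z x - totalEnergyDensity (ρ 0 x) (u 0 x) (θ 0 x)| with hD
    have hGG : |G q - G (pmap x)| ≤ ε / (B * R + 1) + 2 * max |a| |b| / δ * D :=
      abs_sub_le_of_modulus (hGM q) (hGM (pmap x)) hδ hε₁.le
        (fun h => hmodK (pmap x) ⟨x, rfl⟩ q h) (dist_le_sum3 q (pmap x))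
    have hrD : |boxDensity σ ℓ Φ N 0 z x - ρ 0 x| ≤ D := by
      rw [hD]
      linarith [norm_nonneg (boxMomentum σ ℓ Φ N 0 z x - ρ 0 x • u 0 x),
        abs_nonneg (boxEnergy σ ℓ Φ N 0 z x - totalEnergyDensity (ρ 0 x) (u 0 x) (θ 0 x))]
    have hmain := abs_mul_mul_sub_le (r := boxDensity σ ℓ Φ N 0 z x) (p := φ 0 x) (hGM q) hGG
      hrD (hR x) (hB x) hε₁.le (by positivity)
    have hsmall : B * R * (ε / (B * R + 1)) ≤ ε := by
      rw [← mul_div_assoc, div_le_iff₀ (by positivity)]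
      nlinarith [mul_nonneg hB0 hR0]
    have hGq : boxClampedEntropy σ η₁ ℓ Φ a b N 0 z x = G q := rfl
    rw [hGq, ← hGp x]
    linarith
  -- assembly
  exact tendsto_lintegral_abs_integral_sub (fun N => localGibbsLaw σ a₀ u₀ θ₀ N (Φ N)) hP volume
    (fun N z x => boxDensity σ ℓ Φ N 0 z x * boxClampedEntropy σ η₁ ℓ Φ a b N 0 z x * φ 0 x)
    (fun x => ρ 0 x * clamp a b (cutEntropy σ η₁ (ρ 0 x) (θ 0 x)) * φ 0 x)
    (fun N z x => |boxDensity σ ℓ Φ N 0 z x - ρ 0 x| + ‖boxMomentum σ ℓ Φ N 0 z x - ρ 0 x • u 0 x‖ +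
      |boxEnergy σ ℓ Φ N 0 z x - totalEnergyDensity (ρ 0 x) (u 0 x) (θ 0 x)|)
    hconv hfi hgi hdevi (fun N z x => by positivity) hpt

end Summit.AtomisticToContinuum.HydrodynamicLimit.Theorems.EABirthS0b

end
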